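import Summits.Ventures.QEC.Census.BB.A1s_n84_k6_0410d1fb.Cert
import Literature.InformationTheory.QuantumCodes.TwoBlockConnectedComponents
import Literature.InformationTheory.QuantumCodes.TwoBlockToricLayout
import Literature.InformationTheory.QuantumCodes.TwoBlockWheelComponents
import HarnessLib
import HarnessLib.Audit.Tags
import Summits.Ventures.QEC.Census.BB.A1s_n90_k4_1f2d0ff1.Cert
import Summits.Ventures.QEC.Census.BB.A1s_n96_k4_844e2ccd.Cert
import Summits.Ventures.QEC.Census.BB.A1s_n98_k6_22c871c0.Cert

/-!
# The δ-lane A.1 census rows (typed codes `<Row>.code : BB.Code ℓ m` of `Census/BB/<Row>/Cert.lean`): LAYOUT columns in the kernel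
# — Bravyi et al. 2024 §5 Lemma 3 (connected), Lemma 4 (toric layout, where applicable), Lemma 2 minus planarity (wheel layers);
# batch 2 of 2 (4 rows)

Rows: `A1s_n84_k6_0410d1fb`, `A1s_n90_k4_1f2d0ff1`, `A1s_n96_k4_844e2ccd`, `A1s_n98_k6_22c871c0`. Per row (namespace `Summit.Ventures.QEC.Census.<Row>`):
`code_tannerGraph_connected` (`BB.Code.tannerGraph_connected_of_unit_mem` with explicit multiples of exponent differences);
`code_hasToricLayoutWith μ λ` / `code_hasToricLayout` (`BB.Code.hasToricLayoutWith_of_exponents`) when two exponent differences of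
complementary orders generate `ℤ_ℓ × ℤ_m` (Lemma 4's sufficient condition; omitted otherwise); `code_wheel_layers`
(`BB.Code.exists_wheel_layers`: two edge-disjoint layers of wheel graphs `prismGraph 2·ord(A₃A₂ᵀ)` / `prismGraph 2·ord(B₂B₁ᵀ)`;
planarity itself is not asserted). All small arithmetic facts `decide`d on the literal data (tools/conn_cert.py finds the witnesses).
These rows already carry `BB.HasParams code n k d` in their `Distance.lean`. Companion of `Census/BB/Layout.lean` / `WheelLayers.lean`
(the Table-3 codes) and of the bridge files `Census/BB/*QC.lean`. KERNEL; axioms standard; no `native_decide`.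
-/

namespace Summit.Ventures.QEC.Census.A1s_n84_k6_0410d1fb

open SimpleGraph Literature.InformationTheory.QuantumCodes

set_option maxRecDepth 100000 in
/-- **The Tanner graph of `A1s_n84_k6_0410d1fb.code` is connected** (BCGMRY24 Lemma 3: `x`, `y` are explicit combinations of exponent differences inside `A`
or inside `B`). Census column «connected» = true, KERNEL. -/
theorem code_tannerGraph_connected : A1s_n84_k6_0410d1fb.code.css.tannerGraph.Connected := by
  refine A1s_n84_k6_0410d1fb.code.tannerGraph_connected_of_unit_mem (fun h => absurd (congrFun h ((0 : Fin 2), (1 : Fin 21))) (by decide))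
    (fun h => absurd (congrFun h ((0 : Fin 2), (11 : Fin 21))) (by decide)) ?_ ?_
  · have e : (((1 : Fin 2), (0 : Fin 21)) : BB.Mono 2 21) = (21 : ℕ) • (((0 : Fin 2), (1 : Fin 21)) - (1, 0)) := by decide
    rw [e]
    exact (AddSubgroup.nsmul_mem _ (A1s_n84_k6_0410d1fb.code.sub_mem_expDiffSubgroup_A (by decide) (by decide)) 21)
  · have e : (((0 : Fin 2), (1 : Fin 21)) : BB.Mono 2 21) = (10 : ℕ) • (((0 : Fin 2), (1 : Fin 21)) - (0, 3)) := by decide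
    rw [e]
    exact (AddSubgroup.nsmul_mem _ (A1s_n84_k6_0410d1fb.code.sub_mem_expDiffSubgroup_A (by decide) (by decide)) 10)


set_option maxRecDepth 100000 in
/-- **`A1s_n84_k6_0410d1fb.code`**: Tanner graph = edge-disjoint union of two layers whose components are wheel graphs `prismGraph 28` (`A₃A₂ᵀ` of order
`14`) and `prismGraph 42` (`B₂B₁ᵀ` of order `21`) — BCGMRY24 Lemma 2 minus planarity (`BB.Code.exists_wheel_layers`). KERNEL. -/
theorem code_wheel_layers :
    ∃ ΓA ΓB : SimpleGraph ((BB.Mono 2 21 ⊕ BB.Mono 2 21) ⊕ (BB.Mono 2 21 ⊕ BB.Mono 2 21)),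
    A1s_n84_k6_0410d1fb.code.css.tannerGraph = ΓA ⊔ ΓB ∧ Disjoint ΓA ΓB ∧
    (∀ K : ΓA.ConnectedComponent, Nonempty (K.toSimpleGraph ≃g prismGraph 28)) ∧
    (∀ K : ΓB.ConnectedComponent, Nonempty (K.toSimpleGraph ≃g prismGraph 42)) := by
  have hA : ∀ g : BB.Mono 2 21, A1s_n84_k6_0410d1fb.code.A g ≠ 0 ↔ g = ((0 : Fin 2), (1 : Fin 21)) ∨ g = ((0 : Fin 2), (3 : Fin 21)) ∨ g = ((1 : Fin 2), (0 : Fin 21)) := by decide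
  have hB : ∀ g : BB.Mono 2 21, A1s_n84_k6_0410d1fb.code.B g ≠ 0 ↔ g = ((0 : Fin 2), (11 : Fin 21)) ∨ g = ((0 : Fin 2), (19 : Fin 21)) ∨ g = ((1 : Fin 2), (0 : Fin 21)) := by decide
  have h := A1s_n84_k6_0410d1fb.code.exists_wheel_layers (g₁ := ((0 : Fin 2), (1 : Fin 21))) (g₂ := ((0 : Fin 2), (3 : Fin 21))) (g₃ := ((1 : Fin 2), (0 : Fin 21))) (h₁ := ((0 : Fin 2), (11 : Fin 21)))
    (h₂ := ((0 : Fin 2), (19 : Fin 21))) (h₃ := ((1 : Fin 2), (0 : Fin 21))) (by decide) (by decide) (by decide) (by decide) (by decide) (by decide) hA hB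
  have e1 : addOrderOf (((1 : Fin 2), (0 : Fin 21)) - (0, 3)) = 14 := (addOrderOf_eq_iff (by norm_num)).mpr (by decide)
  have e2 : addOrderOf (((0 : Fin 2), (19 : Fin 21)) - (0, 11)) = 21 := (addOrderOf_eq_iff (by norm_num)).mpr (by decide)
  rw [e1, e2] at h
  exact h

end Summit.Ventures.QEC.Census.A1s_n84_k6_0410d1fb

namespace Summit.Ventures.QEC.Census.A1s_n90_k4_1f2d0ff1

open SimpleGraph Literature.InformationTheory.QuantumCodes

set_option maxRecDepth 100000 in
/-- **The Tanner graph of `A1s_n90_k4_1f2d0ff1.code` is connected** (BCGMRY24 Lemma 3: `x`, `y` are explicit combinations of exponent differences inside `A`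
or inside `B`). Census column «connected» = true, KERNEL. -/
theorem code_tannerGraph_connected : A1s_n90_k4_1f2d0ff1.code.css.tannerGraph.Connected := by
  refine A1s_n90_k4_1f2d0ff1.code.tannerGraph_connected_of_unit_mem (fun h => absurd (congrFun h ((0 : Fin 3), (0 : Fin 15))) (by decide))
    (fun h => absurd (congrFun h ((0 : Fin 3), (0 : Fin 15))) (by decide)) ?_ ?_
  · have e : (((1 : Fin 3), (0 : Fin 15)) : BB.Mono 3 15) = (2 : ℕ) • (((0 : Fin 3), (0 : Fin 15)) - (1, 0)) := by decide
    rw [e]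
    exact (AddSubgroup.nsmul_mem _ (A1s_n90_k4_1f2d0ff1.code.sub_mem_expDiffSubgroup_B (by decide) (by decide)) 2)
  · have e : (((0 : Fin 3), (1 : Fin 15)) : BB.Mono 3 15) = (14 : ℕ) • (((0 : Fin 3), (0 : Fin 15)) - (0, 1)) := by decide
    rw [e]
    exact (AddSubgroup.nsmul_mem _ (A1s_n90_k4_1f2d0ff1.code.sub_mem_expDiffSubgroup_A (by decide) (by decide)) 14)


/-- The two layout generators generate `ℤ_3 × ℤ_15` (explicit multiples giving `x` and `y`). -/
theorem code_layout_closure_eq_top : AddSubgroup.closure ({((0 : Fin 3), (0 : Fin 15)) - (0, 1), ((0 : Fin 3), (0 : Fin 15)) - (1, 0)} : Set (BB.Mono 3 15)) = ⊤ := by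
  apply BB.Code.addSubgroup_eq_top_of_unit_mem
  · have h1 := AddSubgroup.subset_closure (k := ({((0 : Fin 3), (0 : Fin 15)) - (0, 1), ((0 : Fin 3), (0 : Fin 15)) - (1, 0)} : Set (BB.Mono 3 15))) (Set.mem_insert _ _)
    have h2 := AddSubgroup.subset_closure (k := ({((0 : Fin 3), (0 : Fin 15)) - (0, 1), ((0 : Fin 3), (0 : Fin 15)) - (1, 0)} : Set (BB.Mono 3 15))) (Set.mem_insert_of_mem _ rfl)
    have e : (0 : ℕ) • (((0 : Fin 3), (0 : Fin 15)) - (0, 1)) + (2 : ℕ) • (((0 : Fin 3), (0 : Fin 15)) - (1, 0)) = (1, 0) := by decide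
    have h' := AddSubgroup.add_mem _ (AddSubgroup.nsmul_mem _ h1 0) (AddSubgroup.nsmul_mem _ h2 2)
    rw [e] at h'
    exact h'
  · have h1 := AddSubgroup.subset_closure (k := ({((0 : Fin 3), (0 : Fin 15)) - (0, 1), ((0 : Fin 3), (0 : Fin 15)) - (1, 0)} : Set (BB.Mono 3 15))) (Set.mem_insert _ _)
    have h2 := AddSubgroup.subset_closure (k := ({((0 : Fin 3), (0 : Fin 15)) - (0, 1), ((0 : Fin 3), (0 : Fin 15)) - (1, 0)} : Set (BB.Mono 3 15))) (Set.mem_insert_of_mem _ rfl)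
    have e : (14 : ℕ) • (((0 : Fin 3), (0 : Fin 15)) - (0, 1)) + (0 : ℕ) • (((0 : Fin 3), (0 : Fin 15)) - (1, 0)) = (0, 1) := by decide
    have h' := AddSubgroup.add_mem _ (AddSubgroup.nsmul_mem _ h1 14) (AddSubgroup.nsmul_mem _ h2 0)
    rw [e] at h'
    exact h'

set_option maxRecDepth 100000 in
/-- Orders of the two layout generators: `15` and `3`. -/
theorem code_layout_orders : addOrderOf (((0 : Fin 3), (0 : Fin 15)) - (0, 1)) = 15 ∧ addOrderOf (((0 : Fin 3), (0 : Fin 15)) - (1, 0)) = 3 :=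
  ⟨(addOrderOf_eq_iff (by norm_num)).mpr (by decide), (addOrderOf_eq_iff (by norm_num)).mpr (by decide)⟩

/-- **`A1s_n90_k4_1f2d0ff1.code` has a toric layout with `(μ, λ) = (15, 3)`** (BCGMRY24 Lemma 4). Census layout column, KERNEL. -/
theorem code_hasToricLayoutWith : HasToricLayoutWith 15 3 A1s_n90_k4_1f2d0ff1.code.css.tannerGraph := by
  have h := A1s_n90_k4_1f2d0ff1.code.hasToricLayoutWith_of_exponents (g := ((0 : Fin 3), (0 : Fin 15))) (g' := (0, 1))
    (h := ((0 : Fin 3), (0 : Fin 15))) (h' := (1, 0)) (by decide) (by decide) (by decide) (by decide)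
    code_layout_closure_eq_top (by rw [code_layout_orders.1, code_layout_orders.2])
  rwa [code_layout_orders.1, code_layout_orders.2] at h

/-- `A1s_n90_k4_1f2d0ff1.code` has a toric layout. KERNEL. -/
theorem code_hasToricLayout : HasToricLayout A1s_n90_k4_1f2d0ff1.code.css.tannerGraph :=
  ⟨15, 3, by norm_num, by norm_num, code_hasToricLayoutWith⟩


set_option maxRecDepth 100000 in
/-- **`A1s_n90_k4_1f2d0ff1.code`**: Tanner graph = edge-disjoint union of two layers whose components are wheel graphs `prismGraph 30` (`A₃A₂ᵀ` of order
`15`) and `prismGraph 30` (`B₂B₁ᵀ` of order `15`) — BCGMRY24 Lemma 2 minus planarity (`BB.Code.exists_wheel_layers`). KERNEL. -/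
theorem code_wheel_layers :
    ∃ ΓA ΓB : SimpleGraph ((BB.Mono 3 15 ⊕ BB.Mono 3 15) ⊕ (BB.Mono 3 15 ⊕ BB.Mono 3 15)),
    A1s_n90_k4_1f2d0ff1.code.css.tannerGraph = ΓA ⊔ ΓB ∧ Disjoint ΓA ΓB ∧
    (∀ K : ΓA.ConnectedComponent, Nonempty (K.toSimpleGraph ≃g prismGraph 30)) ∧
    (∀ K : ΓB.ConnectedComponent, Nonempty (K.toSimpleGraph ≃g prismGraph 30)) := by
  have hA : ∀ g : BB.Mono 3 15, A1s_n90_k4_1f2d0ff1.code.A g ≠ 0 ↔ g = ((0 : Fin 3), (0 : Fin 15)) ∨ g = ((0 : Fin 3), (1 : Fin 15)) ∨ g = ((0 : Fin 3), (5 : Fin 15)) := by decide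
  have hB : ∀ g : BB.Mono 3 15, A1s_n90_k4_1f2d0ff1.code.B g ≠ 0 ↔ g = ((0 : Fin 3), (0 : Fin 15)) ∨ g = ((0 : Fin 3), (14 : Fin 15)) ∨ g = ((1 : Fin 3), (0 : Fin 15)) := by decide
  have h := A1s_n90_k4_1f2d0ff1.code.exists_wheel_layers (g₁ := ((0 : Fin 3), (0 : Fin 15))) (g₂ := ((0 : Fin 3), (1 : Fin 15))) (g₃ := ((0 : Fin 3), (5 : Fin 15))) (h₁ := ((0 : Fin 3), (0 : Fin 15)))
    (h₂ := ((0 : Fin 3), (14 : Fin 15))) (h₃ := ((1 : Fin 3), (0 : Fin 15))) (by decide) (by decide) (by decide) (by decide) (by decide) (by decide) hA hB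
  have e1 : addOrderOf (((0 : Fin 3), (5 : Fin 15)) - (0, 1)) = 15 := (addOrderOf_eq_iff (by norm_num)).mpr (by decide)
  have e2 : addOrderOf (((0 : Fin 3), (14 : Fin 15)) - (0, 0)) = 15 := (addOrderOf_eq_iff (by norm_num)).mpr (by decide)
  rw [e1, e2] at h
  exact h

end Summit.Ventures.QEC.Census.A1s_n90_k4_1f2d0ff1

namespace Summit.Ventures.QEC.Census.A1s_n96_k4_844e2ccd

open SimpleGraph Literature.InformationTheory.QuantumCodes

set_option maxRecDepth 100000 in
/-- **The Tanner graph of `A1s_n96_k4_844e2ccd.code` is connected** (BCGMRY24 Lemma 3: `x`, `y` are explicit combinations of exponent differences inside `A`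
or inside `B`). Census column «connected» = true, KERNEL. -/
theorem code_tannerGraph_connected : A1s_n96_k4_844e2ccd.code.css.tannerGraph.Connected := by
  refine A1s_n96_k4_844e2ccd.code.tannerGraph_connected_of_unit_mem (fun h => absurd (congrFun h ((0 : Fin 2), (0 : Fin 24))) (by decide))
    (fun h => absurd (congrFun h ((0 : Fin 2), (1 : Fin 24))) (by decide)) ?_ ?_
  · have e : (((1 : Fin 2), (0 : Fin 24)) : BB.Mono 2 24) = (1 : ℕ) • (((0 : Fin 2), (0 : Fin 24)) - (0, 1)) + (1 : ℕ) • (((0 : Fin 2), (1 : Fin 24)) - (1, 0)) := by decide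
    rw [e]
    exact (AddSubgroup.add_mem _ (AddSubgroup.nsmul_mem _ (A1s_n96_k4_844e2ccd.code.sub_mem_expDiffSubgroup_A (by decide) (by decide)) 1) (AddSubgroup.nsmul_mem _ (A1s_n96_k4_844e2ccd.code.sub_mem_expDiffSubgroup_B (by decide) (by decide)) 1))
  · have e : (((0 : Fin 2), (1 : Fin 24)) : BB.Mono 2 24) = (23 : ℕ) • (((0 : Fin 2), (0 : Fin 24)) - (0, 1)) := by decide
    rw [e]
    exact (AddSubgroup.nsmul_mem _ (A1s_n96_k4_844e2ccd.code.sub_mem_expDiffSubgroup_A (by decide) (by decide)) 23)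


set_option maxRecDepth 100000 in
/-- **`A1s_n96_k4_844e2ccd.code`**: Tanner graph = edge-disjoint union of two layers whose components are wheel graphs `prismGraph 24` (`A₃A₂ᵀ` of order
`12`) and `prismGraph 48` (`B₂B₁ᵀ` of order `24`) — BCGMRY24 Lemma 2 minus planarity (`BB.Code.exists_wheel_layers`). KERNEL. -/
theorem code_wheel_layers :
    ∃ ΓA ΓB : SimpleGraph ((BB.Mono 2 24 ⊕ BB.Mono 2 24) ⊕ (BB.Mono 2 24 ⊕ BB.Mono 2 24)),
    A1s_n96_k4_844e2ccd.code.css.tannerGraph = ΓA ⊔ ΓB ∧ Disjoint ΓA ΓB ∧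
    (∀ K : ΓA.ConnectedComponent, Nonempty (K.toSimpleGraph ≃g prismGraph 24)) ∧
    (∀ K : ΓB.ConnectedComponent, Nonempty (K.toSimpleGraph ≃g prismGraph 48)) := by
  have hA : ∀ g : BB.Mono 2 24, A1s_n96_k4_844e2ccd.code.A g ≠ 0 ↔ g = ((0 : Fin 2), (0 : Fin 24)) ∨ g = ((0 : Fin 2), (1 : Fin 24)) ∨ g = ((0 : Fin 2), (11 : Fin 24)) := by decide
  have hB : ∀ g : BB.Mono 2 24, A1s_n96_k4_844e2ccd.code.B g ≠ 0 ↔ g = ((0 : Fin 2), (1 : Fin 24)) ∨ g = ((0 : Fin 2), (20 : Fin 24)) ∨ g = ((1 : Fin 2), (0 : Fin 24)) := by decide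
  have h := A1s_n96_k4_844e2ccd.code.exists_wheel_layers (g₁ := ((0 : Fin 2), (0 : Fin 24))) (g₂ := ((0 : Fin 2), (1 : Fin 24))) (g₃ := ((0 : Fin 2), (11 : Fin 24))) (h₁ := ((0 : Fin 2), (1 : Fin 24)))
    (h₂ := ((0 : Fin 2), (20 : Fin 24))) (h₃ := ((1 : Fin 2), (0 : Fin 24))) (by decide) (by decide) (by decide) (by decide) (by decide) (by decide) hA hB
  have e1 : addOrderOf (((0 : Fin 2), (11 : Fin 24)) - (0, 1)) = 12 := (addOrderOf_eq_iff (by norm_num)).mpr (by decide)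
  have e2 : addOrderOf (((0 : Fin 2), (20 : Fin 24)) - (0, 1)) = 24 := (addOrderOf_eq_iff (by norm_num)).mpr (by decide)
  rw [e1, e2] at h
  exact h

end Summit.Ventures.QEC.Census.A1s_n96_k4_844e2ccd

namespace Summit.Ventures.QEC.Census.A1s_n98_k6_22c871c0

open SimpleGraph Literature.InformationTheory.QuantumCodes

set_option maxRecDepth 100000 in
/-- **The Tanner graph of `A1s_n98_k6_22c871c0.code` is connected** (BCGMRY24 Lemma 3: `x`, `y` are explicit combinations of exponent differences inside `A`
or inside `B`). Census column «connected» = true, KERNEL. -/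
theorem code_tannerGraph_connected : A1s_n98_k6_22c871c0.code.css.tannerGraph.Connected := by
  refine A1s_n98_k6_22c871c0.code.tannerGraph_connected_of_unit_mem (fun h => absurd (congrFun h ((0 : Fin 7), (5 : Fin 7))) (by decide))
    (fun h => absurd (congrFun h ((0 : Fin 7), (5 : Fin 7))) (by decide)) ?_ ?_
  · have e : (((1 : Fin 7), (0 : Fin 7)) : BB.Mono 7 7) = (2 : ℕ) • (((3 : Fin 7), (0 : Fin 7)) - (6, 0)) := by decide
    rw [e]
    exact (AddSubgroup.nsmul_mem _ (A1s_n98_k6_22c871c0.code.sub_mem_expDiffSubgroup_B (by decide) (by decide)) 2)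
  · have e : (((0 : Fin 7), (1 : Fin 7)) : BB.Mono 7 7) = (6 : ℕ) • (((0 : Fin 7), (5 : Fin 7)) - (0, 6)) := by decide
    rw [e]
    exact (AddSubgroup.nsmul_mem _ (A1s_n98_k6_22c871c0.code.sub_mem_expDiffSubgroup_A (by decide) (by decide)) 6)


/-- The two layout generators generate `ℤ_7 × ℤ_7` (explicit multiples giving `x` and `y`). -/
theorem code_layout_closure_eq_top : AddSubgroup.closure ({((0 : Fin 7), (5 : Fin 7)) - (0, 6), ((0 : Fin 7), (5 : Fin 7)) - (3, 0)} : Set (BB.Mono 7 7)) = ⊤ := by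
  apply BB.Code.addSubgroup_eq_top_of_unit_mem
  · have h1 := AddSubgroup.subset_closure (k := ({((0 : Fin 7), (5 : Fin 7)) - (0, 6), ((0 : Fin 7), (5 : Fin 7)) - (3, 0)} : Set (BB.Mono 7 7))) (Set.mem_insert _ _)
    have h2 := AddSubgroup.subset_closure (k := ({((0 : Fin 7), (5 : Fin 7)) - (0, 6), ((0 : Fin 7), (5 : Fin 7)) - (3, 0)} : Set (BB.Mono 7 7))) (Set.mem_insert_of_mem _ rfl)
    have e : (3 : ℕ) • (((0 : Fin 7), (5 : Fin 7)) - (0, 6)) + (2 : ℕ) • (((0 : Fin 7), (5 : Fin 7)) - (3, 0)) = (1, 0) := by decide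
    have h' := AddSubgroup.add_mem _ (AddSubgroup.nsmul_mem _ h1 3) (AddSubgroup.nsmul_mem _ h2 2)
    rw [e] at h'
    exact h'
  · have h1 := AddSubgroup.subset_closure (k := ({((0 : Fin 7), (5 : Fin 7)) - (0, 6), ((0 : Fin 7), (5 : Fin 7)) - (3, 0)} : Set (BB.Mono 7 7))) (Set.mem_insert _ _)
    have h2 := AddSubgroup.subset_closure (k := ({((0 : Fin 7), (5 : Fin 7)) - (0, 6), ((0 : Fin 7), (5 : Fin 7)) - (3, 0)} : Set (BB.Mono 7 7))) (Set.mem_insert_of_mem _ rfl)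
    have e : (6 : ℕ) • (((0 : Fin 7), (5 : Fin 7)) - (0, 6)) + (0 : ℕ) • (((0 : Fin 7), (5 : Fin 7)) - (3, 0)) = (0, 1) := by decide
    have h' := AddSubgroup.add_mem _ (AddSubgroup.nsmul_mem _ h1 6) (AddSubgroup.nsmul_mem _ h2 0)
    rw [e] at h'
    exact h'

set_option maxRecDepth 100000 in
/-- Orders of the two layout generators: `7` and `7`. -/
theorem code_layout_orders : addOrderOf (((0 : Fin 7), (5 : Fin 7)) - (0, 6)) = 7 ∧ addOrderOf (((0 : Fin 7), (5 : Fin 7)) - (3, 0)) = 7 :=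
  ⟨(addOrderOf_eq_iff (by norm_num)).mpr (by decide), (addOrderOf_eq_iff (by norm_num)).mpr (by decide)⟩

/-- **`A1s_n98_k6_22c871c0.code` has a toric layout with `(μ, λ) = (7, 7)`** (BCGMRY24 Lemma 4). Census layout column, KERNEL. -/
theorem code_hasToricLayoutWith : HasToricLayoutWith 7 7 A1s_n98_k6_22c871c0.code.css.tannerGraph := by
  have h := A1s_n98_k6_22c871c0.code.hasToricLayoutWith_of_exponents (g := ((0 : Fin 7), (5 : Fin 7))) (g' := (0, 6))
    (h := ((0 : Fin 7), (5 : Fin 7))) (h' := (3, 0)) (by decide) (by decide) (by decide) (by decide)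
    code_layout_closure_eq_top (by rw [code_layout_orders.1, code_layout_orders.2])
  rwa [code_layout_orders.1, code_layout_orders.2] at h

/-- `A1s_n98_k6_22c871c0.code` has a toric layout. KERNEL. -/
theorem code_hasToricLayout : HasToricLayout A1s_n98_k6_22c871c0.code.css.tannerGraph :=
  ⟨7, 7, by norm_num, by norm_num, code_hasToricLayoutWith⟩


set_option maxRecDepth 100000 in
/-- **`A1s_n98_k6_22c871c0.code`**: Tanner graph = edge-disjoint union of two layers whose components are wheel graphs `prismGraph 14` (`A₃A₂ᵀ` of order
`7`) and `prismGraph 14` (`B₂B₁ᵀ` of order `7`) — BCGMRY24 Lemma 2 minus planarity (`BB.Code.exists_wheel_layers`). KERNEL. -/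
theorem code_wheel_layers :
    ∃ ΓA ΓB : SimpleGraph ((BB.Mono 7 7 ⊕ BB.Mono 7 7) ⊕ (BB.Mono 7 7 ⊕ BB.Mono 7 7)),
    A1s_n98_k6_22c871c0.code.css.tannerGraph = ΓA ⊔ ΓB ∧ Disjoint ΓA ΓB ∧
    (∀ K : ΓA.ConnectedComponent, Nonempty (K.toSimpleGraph ≃g prismGraph 14)) ∧
    (∀ K : ΓB.ConnectedComponent, Nonempty (K.toSimpleGraph ≃g prismGraph 14)) := by
  have hA : ∀ g : BB.Mono 7 7, A1s_n98_k6_22c871c0.code.A g ≠ 0 ↔ g = ((0 : Fin 7), (5 : Fin 7)) ∨ g = ((0 : Fin 7), (6 : Fin 7)) ∨ g = ((1 : Fin 7), (0 : Fin 7)) := by decide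
  have hB : ∀ g : BB.Mono 7 7, A1s_n98_k6_22c871c0.code.B g ≠ 0 ↔ g = ((0 : Fin 7), (5 : Fin 7)) ∨ g = ((3 : Fin 7), (0 : Fin 7)) ∨ g = ((6 : Fin 7), (0 : Fin 7)) := by decide
  have h := A1s_n98_k6_22c871c0.code.exists_wheel_layers (g₁ := ((0 : Fin 7), (5 : Fin 7))) (g₂ := ((0 : Fin 7), (6 : Fin 7))) (g₃ := ((1 : Fin 7), (0 : Fin 7))) (h₁ := ((0 : Fin 7), (5 : Fin 7)))
    (h₂ := ((3 : Fin 7), (0 : Fin 7))) (h₃ := ((6 : Fin 7), (0 : Fin 7))) (by decide) (by decide) (by decide) (by decide) (by decide) (by decide) hA hB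
  have e1 : addOrderOf (((1 : Fin 7), (0 : Fin 7)) - (0, 6)) = 7 := (addOrderOf_eq_iff (by norm_num)).mpr (by decide)
  have e2 : addOrderOf (((3 : Fin 7), (0 : Fin 7)) - (0, 5)) = 7 := (addOrderOf_eq_iff (by norm_num)).mpr (by decide)
  rw [e1, e2] at h
  exact h

end Summit.Ventures.QEC.Census.A1s_n98_k6_22c871c0
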